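import Literature.AlgebraicGeometry.Morphisms.ClosedImmersionNearFibreAffine
import Literature.AlgebraicGeometry.Motives.ProjectiveOfGeneratingSections
import Mathlib.AlgebraicGeometry.ZariskisMainTheorem
import HarnessLib

/-!
# A proper morphism which is a closed immersion on a fibre is a closed immersion near that fibre (EGA III 4.6.7 (ii))

Topic `AlgebraicGeometry/Morphisms`; namespace `Literature.AlgebraicGeometry.Morphisms`. THEOREMS ONLY (no definition, no named fact,
no instance, no `sorry`).

Let `f : X → S` be PROPER, `q : P → S` separated, `g : X → P` an `S`-morphism (`g ≫ q = f`) and `s ∈ S`. Suppose the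
scheme-theoretic fibre of `g` at every point `p` of `P` over `s` is a closed immersion into `Spec κ(p)` (i.e. empty or the reduced
point — the pointwise form of «`g_s : X_s → P_s` is a closed immersion»). Then `g` is a CLOSED IMMERSION over `q⁻¹(U)` for some
open neighbourhood `U` of `s` (EGA III 4.6.7 (ii); the key step of EGA III 4.7.1 «ample on the fibre ⇒ relatively ample near the
fibre»). Proof: `g` is proper (`q` separated), with finite fibres at the points over `s`, hence FINITE over a neighbourhood of each
such point (Mathlib's Zariski-Main-Theorem form `exists_isFinite_morphismRestrict_of_finite_preimage_singleton`); over an affine such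
neighbourhood `Spec R` with `g⁻¹ = Spec B`, `B` is a finite `R`-module, the fibre condition transports along the restriction and
`Spec` squares (all cartesian), and ★ `exists_isClosedImmersion_SpecMap_away_tensor_of_fiber` (Nakayama) gives `r ∉ 𝔭` with
`Spec (R_r ⊗_R B) → Spec R_r` a closed immersion — which is `g` restricted over the image of `Spec R_r` in `P`. The union `W` of
these opens contains `f⁻¹(s)`'s image; as `f` is closed, `U := S ∖ f(X ∖ g⁻¹W)` is an open neighbourhood of `s` with
`g(f⁻¹U) ⊆ W`, and being a closed immersion is local on the target over opens covering the range (Mathlib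
`IsZariskiLocalAtTarget.of_range_subset_iSup`).

* `finite_preimage_singleton_of_isClosedImmersion_fiber` — a fibre which is a closed immersion into `Spec κ(p)` has at most one
  point;
* `exists_isClosedImmersion_morphismRestrict_nhd_of_fiber` — the LOCAL statement at a point `p` for a proper `g`:
  `∃ V ∋ p` open with `g ∣_ V` a closed immersion;
* `isClosedImmersion_fiberToSpecResidueField_of_fiber` — (via the private square `X_s = X ×_P P_s`) a closed immersion
  `X_s → P_s` of fibres makes every pointwise fibre `g⁻¹(p) → Spec κ(p)` (`p` over `s`) a closed immersion;
* **`exists_isClosedImmersion_morphismRestrict_preimage_of_fiber`** — the statement above (pointwise-fibre hypothesis), and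
  **`exists_isClosedImmersion_morphismRestrict_preimage_of_fiberHom`** — the same with the hypothesis on `X_s → P_s`;
* `isClosedImmersion_pullbackMap_of_isOpenImmersion` (edition 2) — closed immersion over `q⁻¹(U)` ⇒ the base change along
  any open immersion `T → S` landing in `U` is a closed immersion;
* `exists_isClosedImmersion_pullbackMap_away_of_morphismRestrict`, **`exists_isClosedImmersion_pullbackMap_away_of_fiber`**,
  **`exists_isClosedImmersion_pullbackMap_away_of_fiberHom`** (edition 2) — affine base `Spec A`: the conclusion as «for some
  `r ∉ 𝔭` the base change `X ×_A A_r → P ×_A A_r` (`pullback.map` along `Spec A_r → Spec A`) is a closed immersion».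

Cell `hodgecm-mathlib`, F-DAG first hand (h2) «relative ampleness» (price sheet v0.1 §3 F-2a / §5 item 2), leaf (A); consumer: the
EGA III 4.7.1 assembly (leaf (B)) and F-6/F-9. Count-neutral capital (HC_CM is proved only modulo the 7 printed citations until
rung 0 closes).

## References
* A. Grothendieck, J. Dieudonné, *EGA III₁* (1961), Prop. 4.6.7 (ii), Thm. 4.7.1. [EGAIII1]
* The Stacks Project, Tag 02UP (proper + finite fibre ⇒ finite near the fibre), Tag 04XV. [StacksProject]
* D. Mumford, *Abelian Varieties* (1970), §5 Cor. 3 (p. 53). [MumfordAV1970]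
-/

universe u

open CategoryTheory CategoryTheory.Limits AlgebraicGeometry TopologicalSpace TensorProduct

namespace Literature.AlgebraicGeometry.Morphisms

/-! ### Fibres that are closed immersions into a point -/

section Fibre

variable {X P : Scheme.{u}} (g : X ⟶ P)

/-- If the scheme-theoretic fibre of `g` at `p` is a closed immersion into `Spec κ(p)`, then `g⁻¹(p)` has at most one point, in
particular it is finite. [cite: StacksProject, Tag 02UP] -/
theorem finite_preimage_singleton_of_isClosedImmersion_fiber (p : P)
    (hp : IsClosedImmersion (g.fiberToSpecResidueField p)) : (g ⁻¹' {p}).Finite := by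
  have hinj : Function.Injective (g.fiberToSpecResidueField p) :=
    (g.fiberToSpecResidueField p).isClosedEmbedding.injective
  haveI : Subsingleton (g.fiber p) := ⟨fun a b ↦ hinj (Subsingleton.elim _ _)⟩
  haveI : Finite (g ⁻¹' {p}) := (g.fiberHomeo p).finite_iff.mp inferInstance
  exact Set.toFinite _

end Fibre

/-! ### The local statement at a point of `P` -/

section Local

variable {X P : Scheme.{u}} (g : X ⟶ P) [IsProper g]

omit [IsProper g] in
/-- Restricting over a smaller open: `g ∣_ V₁` is the base change of `g ∣_ V₀` along `V₁ ↪ V₀` (`V₁ ≤ V₀`). [folklore] -/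
private theorem isPullback_morphismRestrict_homOfLE {V₁ V₀ : P.Opens} (hle : V₁ ≤ V₀) :
    IsPullback (X.homOfLE (show g ⁻¹ᵁ V₁ ≤ g ⁻¹ᵁ V₀ from fun _ hx ↦ hle hx)) (g ∣_ V₁) (g ∣_ V₀) (P.homOfLE hle) := by
  have s : IsPullback (X.homOfLE (show g ⁻¹ᵁ V₁ ≤ g ⁻¹ᵁ V₀ from fun _ hx ↦ hle hx) ≫ (g ⁻¹ᵁ V₀).ι) (g ∣_ V₁) g
      (P.homOfLE hle ≫ V₀.ι) := by
    rw [Scheme.homOfLE_ι, Scheme.homOfLE_ι]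
    exact (isPullback_morphismRestrict g V₁).flip
  refine IsPullback.of_right s ?_ (isPullback_morphismRestrict g V₀).flip
  rw [← cancel_mono V₀.ι, Category.assoc, Category.assoc, morphismRestrict_ι, Scheme.homOfLE_ι, Scheme.homOfLE_ι_assoc,
    morphismRestrict_ι]

/-- **Local form at a point.** Let `g : X → P` be proper and `p ∈ P` a point at which the scheme-theoretic fibre of `g` is a
closed immersion into `Spec κ(p)`. Then `g` is a closed immersion over some open neighbourhood `V` of `p`: `g` is finite over a
neighbourhood of `p` (Mathlib `exists_isFinite_morphismRestrict_of_finite_preimage_singleton`, Zariski's Main Theorem), which we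
shrink to an affine `Spec R` with `g⁻¹ = Spec B`, `B` module-finite over `R`; the fibre condition transported to `Spec B → Spec R`
gives `r ∉ 𝔭` with `Spec (R_r ⊗_R B) → Spec R_r` a closed immersion (★ `exists_isClosedImmersion_SpecMap_away_tensor_of_fiber`), and
`g` restricted over the image `V` of `Spec R_r` in `P` is that base change. [cite: EGAIII1, Prop. 4.6.7 (ii)]
[cite: StacksProject, Tag 02UP] -/
theorem exists_isClosedImmersion_morphismRestrict_nhd_of_fiber (p : P)
    (hp : IsClosedImmersion (g.fiberToSpecResidueField p)) :
    ∃ V : P.Opens, p ∈ V ∧ IsClosedImmersion (g ∣_ V) := by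
  -- `g` is finite over a neighbourhood `V₀` of `p`
  obtain ⟨V₀, hpV₀, hfin₀⟩ := exists_isFinite_morphismRestrict_of_finite_preimage_singleton g p
    (finite_preimage_singleton_of_isClosedImmersion_fiber g p hp)
  -- shrink to an affine neighbourhood `V₁ ⊆ V₀`
  obtain ⟨_, ⟨V₁', hV₁', rfl⟩, hpV₁', hle⟩ := P.isBasis_affineOpens.exists_subset_of_mem_open hpV₀ V₀.2
  obtain ⟨V₁, hV₁, hpV₁, hle'⟩ : ∃ V₁ : P.Opens, IsAffineOpen V₁ ∧ p ∈ V₁ ∧ V₁ ≤ V₀ := ⟨V₁', hV₁', hpV₁', hle⟩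
  haveI : IsFinite (g ∣_ V₁) :=
    IsZariskiLocalAtTarget.of_isPullback (isPullback_morphismRestrict_homOfLE g hle') hfin₀
  -- the affine picture `Spec B → Spec R`
  haveI : IsAffine (V₁ : Scheme.{u}) := hV₁
  set g₁ : (g ⁻¹ᵁ V₁ : Scheme.{u}) ⟶ V₁ := g ∣_ V₁ with hg₁
  have hQ := (HasAffineProperty.iff_of_isAffine (P := @IsFinite) (f := g₁)).mp inferInstance
  haveI : IsAffine (g ⁻¹ᵁ V₁ : Scheme.{u}) := hQ.1
  set R : CommRingCat.{u} := Γ(V₁, ⊤) with hR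
  set B : CommRingCat.{u} := Γ(g ⁻¹ᵁ V₁, ⊤) with hB
  set φ : R ⟶ B := g₁.appTop with hφ
  letI : Algebra R B := φ.hom.toAlgebra
  haveI : Module.Finite R B := hQ.2
  have hφeq : CommRingCat.ofHom (algebraMap R B) = φ := by
    rw [RingHom.algebraMap_toAlgebra]; rfl
  -- the point `𝔭 ∈ Spec R` under `p` and the map `j : Spec R ≅ V₁ ↪ P`
  set p₁ : (V₁ : Scheme.{u}) := (⟨p, hpV₁⟩ : V₁) with hp₁
  set 𝔭 : Spec R := (V₁ : Scheme.{u}).isoSpec.hom p₁ with h𝔭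
  set j : Spec R ⟶ P := (V₁ : Scheme.{u}).isoSpec.inv ≫ V₁.ι with hj
  haveI : IsOpenImmersion j := by rw [hj]; infer_instance
  have hj𝔭 : j 𝔭 = p := by
    have h1 : ((V₁ : Scheme.{u}).isoSpec.hom ≫ (V₁ : Scheme.{u}).isoSpec.inv) p₁ = p₁ := by
      rw [Iso.hom_inv_id]; rfl
    rw [Scheme.Hom.comp_apply] at h1
    show ((V₁ : Scheme.{u}).isoSpec.inv ≫ V₁.ι) ((V₁ : Scheme.{u}).isoSpec.hom p₁) = p
    rw [Scheme.Hom.comp_apply, h1]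
    rfl
  -- the square `Spec B → X, Spec.map φ, g, j` is cartesian (restriction square + affine isomorphisms)
  have sqC : IsPullback (g ⁻¹ᵁ V₁).ι g₁ g V₁.ι := (isPullback_morphismRestrict g V₁).flip
  have sqB : IsPullback (g ⁻¹ᵁ V₁ : Scheme.{u}).isoSpec.inv (Spec.map φ) g₁ (V₁ : Scheme.{u}).isoSpec.inv :=
    IsPullback.of_horiz_isIso ⟨(Scheme.isoSpec_inv_naturality g₁).symm⟩
  have sqBC : IsPullback ((g ⁻¹ᵁ V₁ : Scheme.{u}).isoSpec.inv ≫ (g ⁻¹ᵁ V₁).ι) (Spec.map φ) g j :=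
    sqB.paste_horiz sqC
  -- the fibre of `Spec.map φ` at `𝔭` is a base change of the fibre of `g` at `p`: a closed immersion
  have hfib : IsClosedImmersion ((Spec.map (CommRingCat.ofHom (algebraMap R B))).fiberToSpecResidueField 𝔭) := by
    rw [hφeq]
    have sq := isPullback_fiberToSpecResidueField_of_isPullback sqBC 𝔭
    have hp' : IsClosedImmersion (g.fiberToSpecResidueField (j 𝔭)) := by rw [hj𝔭]; exact hp
    exact MorphismProperty.IsStableUnderBaseChange.of_isPullback sq hp'
  -- Nakayama: `Spec (R_r ⊗ B) → Spec R_r` is a closed immersion for some `r ∉ 𝔭`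
  obtain ⟨r, hr, hci⟩ := exists_isClosedImmersion_SpecMap_away_tensor_of_fiber R B 𝔭 hfib
  -- the base-change square of `Spec B → Spec R` to `Spec R_r`
  set loc := CommRingCat.ofHom (algebraMap R (Localization.Away r)) with hloc
  haveI : IsOpenImmersion (Spec.map loc) := by rw [hloc]; infer_instance
  have hincl : (Algebra.TensorProduct.includeLeftRingHom : Localization.Away r →+* Localization.Away r ⊗[R] B) =
      algebraMap (Localization.Away r) (Localization.Away r ⊗[R] B) := RingHom.ext fun _ ↦ rfl
  have sqA : IsPullback
      (Spec.map (CommRingCat.ofHom (Algebra.TensorProduct.includeRight.toRingHom : B →+* Localization.Away r ⊗[R] B)))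
      (Spec.map (CommRingCat.ofHom (algebraMap (Localization.Away r) (Localization.Away r ⊗[R] B))))
      (Spec.map φ) (Spec.map loc) := by
    have h := (isPullback_SpecMap_of_isPushout _ _ _ _ (CommRingCat.isPushout_tensorProduct R (Localization.Away r) B)).flip
    rw [hφeq, hincl] at h
    exact h
  have SQ := sqA.paste_horiz sqBC
  -- `V := ` the image of `Spec R_r → Spec R ≅ V₁ ↪ P`
  set ι' : Spec (CommRingCat.of (Localization.Away r)) ⟶ P := Spec.map loc ≫ j with hι'
  haveI : IsOpenImmersion ι' := by rw [hι']; infer_instance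
  refine ⟨ι'.opensRange, ?_, ?_⟩
  · -- `p ∈ V` since `𝔭 ∈ D(r)`
    have hrange : (Spec.map (CommRingCat.ofHom (algebraMap R (Localization.Away r)))).opensRange =
        PrimeSpectrum.basicOpen r := Scheme.Hom.opensRange_localizationAway (R := R) r
    have h𝔭r : 𝔭 ∈ (Spec.map (CommRingCat.ofHom (algebraMap R (Localization.Away r)))).opensRange := by
      rw [hrange]; exact hr
    obtain ⟨y, hy⟩ := h𝔭r
    refine ⟨y, ?_⟩
    show (Spec.map loc ≫ j) y = p
    rw [Scheme.Hom.comp_apply, ← hj𝔭]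
    exact congrArg j hy
  · -- `g ∣_ V ≅ pullback.snd g ι' ≅ Spec (R_r ⊗ B) → Spec R_r`
    have e1 : Arrow.mk (g ∣_ ι'.opensRange) ≅ Arrow.mk (pullback.snd g ι') := morphismRestrictOpensRange g ι'
    have e2 : Arrow.mk (pullback.snd g ι') ≅
        Arrow.mk (Spec.map (CommRingCat.ofHom (algebraMap (Localization.Away r) (Localization.Away r ⊗[R] B)))) :=
      Arrow.isoMk' _ _ SQ.isoPullback.symm (Iso.refl _) (by
        rw [Iso.refl_hom, Category.comp_id, Iso.symm_hom, Iso.inv_comp_eq, IsPullback.isoPullback_hom_snd])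
    exact (MorphismProperty.arrow_mk_iso_iff @IsClosedImmersion (e1 ≪≫ e2)).mpr hci

end Local


/-! ### From the fibre morphism `X_s → P_s` to the pointwise fibre condition -/

section FibreOverPoint

variable {X P S : Scheme.{u}} (f : X ⟶ S) (q : P ⟶ S) (g : X ⟶ P)

/-- The fibre square: for `g ≫ q = f` and any `gs : X_s → P_s` compatible with the two projections, `X_s` with
`gs` and `X_s → X` is the pullback of `P_s → P` along `g` (`X_s = X ×_S κ(s) = X ×_P P_s`). [folklore] -/
private theorem isPullback_fiber_of_comp_eq (hg : g ≫ q = f) (s : S) (gs : f.fiber s ⟶ q.fiber s)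
    (h₁ : gs ≫ q.fiberι s = f.fiberι s ≫ g)
    (h₂ : gs ≫ q.fiberToSpecResidueField s = f.fiberToSpecResidueField s) :
    IsPullback gs (f.fiberι s) (q.fiberι s) g := by
  have t : IsPullback (q.fiberToSpecResidueField s) (q.fiberι s) (S.fromSpecResidueField s) q :=
    (IsPullback.of_hasPullback q (S.fromSpecResidueField s)).flip
  have big : IsPullback (gs ≫ q.fiberToSpecResidueField s) (f.fiberι s) (S.fromSpecResidueField s) (g ≫ q) := by
    rw [h₂, hg]
    exact (IsPullback.of_hasPullback f (S.fromSpecResidueField s)).flip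
  exact IsPullback.of_right big h₁ t

/-- **Fibre morphism ⇒ pointwise fibres.** Let `g ≫ q = f` and let `gs : X_s → P_s` be a morphism of the fibres over
`s` compatible with the projections to `X`, `P` and to `Spec κ(s)`. If `gs` is a closed immersion, then for every point
`p` of `P` over `s` the scheme-theoretic fibre `g⁻¹(p) → Spec κ(p)` is a closed immersion: it is the base change of `gs`
along `Spec κ(p) → P_s`. [cite: StacksProject, Tag 02UP] -/
theorem isClosedImmersion_fiberToSpecResidueField_of_fiber (hg : g ≫ q = f) (s : S)
    (gs : f.fiber s ⟶ q.fiber s) (h₁ : gs ≫ q.fiberι s = f.fiberι s ≫ g)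
    (h₂ : gs ≫ q.fiberToSpecResidueField s = f.fiberToSpecResidueField s) (hgs : IsClosedImmersion gs)
    (p : P) (hp : q p = s) : IsClosedImmersion (g.fiberToSpecResidueField p) := by
  subst hp
  have SQ1 := isPullback_fiber_of_comp_eq f q g hg (q p) gs h₁ h₂
  -- `Spec κ(p) → P_{q p}`
  have w : P.fromSpecResidueField p ≫ q =
      Spec.map (q.residueFieldMap p) ≫ S.fromSpecResidueField (q p) :=
    (Scheme.Hom.SpecMap_residueFieldMap_fromSpecResidueField q p).symm
  set α : Spec (P.residueField p) ⟶ q.fiber (q p) :=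
    pullback.lift (P.fromSpecResidueField p) (Spec.map (q.residueFieldMap p)) w with hαdef
  have hα : α ≫ q.fiberι (q p) = P.fromSpecResidueField p := pullback.lift_fst _ _ _
  have SQ2 : IsPullback (g.fiberι p) (g.fiberToSpecResidueField p) g (P.fromSpecResidueField p) :=
    IsPullback.of_hasPullback g (P.fromSpecResidueField p)
  -- `g⁻¹(p) → X_{q p}`
  set γ : g.fiber p ⟶ f.fiber (q p) :=
    SQ1.lift (g.fiberToSpecResidueField p ≫ α) (g.fiberι p) (by rw [Category.assoc, hα, ← SQ2.w]) with hγdef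
  have hγ₁ : γ ≫ gs = g.fiberToSpecResidueField p ≫ α := SQ1.lift_fst _ _ _
  have hγ₂ : γ ≫ f.fiberι (q p) = g.fiberι p := SQ1.lift_snd _ _ _
  have big : IsPullback (γ ≫ f.fiberι (q p)) (g.fiberToSpecResidueField p) g (α ≫ q.fiberι (q p)) := by
    rw [hγ₂, hα]; exact SQ2
  have sq : IsPullback γ (g.fiberToSpecResidueField p) gs α := IsPullback.of_right big hγ₁ SQ1.flip
  exact MorphismProperty.IsStableUnderBaseChange.of_isPullback sq hgs

end FibreOverPoint

/-! ### The global statement over a neighbourhood of `s` -/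

section Global

variable {X P S : Scheme.{u}} (f : X ⟶ S) (q : P ⟶ S) (g : X ⟶ P)

/-- **EGA III 4.6.7 (ii): a proper morphism that is a closed immersion on the fibre over `s` is a closed immersion over a
neighbourhood of `s`.** Let `f : X → S` be proper, `q : P → S` separated, `g : X → P` with `g ≫ q = f`, and `s ∈ S` such that
the scheme-theoretic fibre of `g` at every point of `P` over `s` is a closed immersion (into the spectrum of the residue field).
Then there is an open `U ∋ s` with `g ∣_ q⁻¹(U)` a closed immersion. [cite: EGAIII1, Prop. 4.6.7 (ii)] [cite: StacksProject, Tag 02UP] -/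
theorem exists_isClosedImmersion_morphismRestrict_preimage_of_fiber (hg : g ≫ q = f) [IsProper f] [IsSeparated q] (s : S)
    (H : ∀ p : P, q p = s → IsClosedImmersion (g.fiberToSpecResidueField p)) :
    ∃ U : S.Opens, s ∈ U ∧ IsClosedImmersion (g ∣_ q ⁻¹ᵁ U) := by
  haveI : IsProper (g ≫ q) := by rw [hg]; infer_instance
  haveI : IsProper g := IsProper.of_comp g q
  -- for every point of `P` over `s`, an open neighbourhood over which `g` is a closed immersion
  have hloc : ∀ p : {p : P // q p = s}, ∃ V : P.Opens, p.1 ∈ V ∧ IsClosedImmersion (g ∣_ V) := fun p ↦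
    exists_isClosedImmersion_morphismRestrict_nhd_of_fiber g p.1 (H p.1 p.2)
  choose V hpV hV using hloc
  -- their union `W`; `f⁻¹(s) ⊆ g⁻¹(W)`
  set W : P.Opens := ⨆ p, V p with hW
  have hfib : ∀ x : X, f x = s → g x ∈ W := by
    intro x hx
    have hq : q (g x) = s := by rw [← Scheme.Hom.comp_apply, hg]; exact hx
    exact Opens.mem_iSup.mpr ⟨⟨g x, hq⟩, hpV ⟨g x, hq⟩⟩
  -- `U := S ∖ f(X ∖ g⁻¹ W)`, an open neighbourhood of `s` (`f` is closed)
  have hcl : IsClosed (f '' ((g ⁻¹ᵁ W : Set X)ᶜ)) := f.isClosedMap _ (g ⁻¹ᵁ W).isOpen.isClosed_compl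
  set U : S.Opens := ⟨(f '' ((g ⁻¹ᵁ W : Set X)ᶜ))ᶜ, hcl.isOpen_compl⟩ with hU
  refine ⟨U, ?_, ?_⟩
  · rintro ⟨x, hx, hxs⟩
    exact hx (hfib x hxs)
  · -- over `q⁻¹ U` the range of `g` lies in `W`: the restricted opens `(q⁻¹U).ι⁻¹ (V p)` pull back to a cover of the source
    have hcov : ⨆ p, (g ∣_ q ⁻¹ᵁ U) ⁻¹ᵁ ((q ⁻¹ᵁ U).ι ⁻¹ᵁ V p) = ⊤ := by
      rw [← top_le_iff]
      intro x _
      have hxU : f ((g ⁻¹ᵁ q ⁻¹ᵁ U).ι x) ∈ U := by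
        have hx : g ((g ⁻¹ᵁ q ⁻¹ᵁ U).ι x) ∈ q ⁻¹ᵁ U := x.2
        rw [← hg, Scheme.Hom.comp_apply]
        exact hx
      have hxW : g ((g ⁻¹ᵁ q ⁻¹ᵁ U).ι x) ∈ W := by
        by_contra hxW
        exact hxU ⟨_, hxW, rfl⟩
      obtain ⟨p, hp⟩ := Opens.mem_iSup.mp hxW
      refine Opens.mem_iSup.mpr ⟨p, ?_⟩
      change ((g ∣_ q ⁻¹ᵁ U) x).1 ∈ V p
      rwa [← Scheme.Opens.ι_apply, ← Scheme.Hom.comp_apply, morphismRestrict_ι]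
    -- over each such open `g ∣_ q⁻¹U` is a closed immersion (a restriction of `g ∣_ V p`)
    have hV' : ∀ p, IsClosedImmersion ((g ∣_ q ⁻¹ᵁ U) ∣_ ((q ⁻¹ᵁ U).ι ⁻¹ᵁ V p)) := by
      intro p
      have e1 := morphismRestrictRestrict g (q ⁻¹ᵁ U) ((q ⁻¹ᵁ U).ι ⁻¹ᵁ V p)
      have h1 : (q ⁻¹ᵁ U).ι ''ᵁ ((q ⁻¹ᵁ U).ι ⁻¹ᵁ V p) = (V p).ι ''ᵁ ((V p).ι ⁻¹ᵁ (q ⁻¹ᵁ U)) := by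
        rw [Scheme.Hom.image_preimage_eq_opensRange_inf, Scheme.Hom.image_preimage_eq_opensRange_inf,
          Scheme.Opens.opensRange_ι, Scheme.Opens.opensRange_ι, inf_comm]
      have e2 := morphismRestrictRestrict g (V p) ((V p).ι ⁻¹ᵁ (q ⁻¹ᵁ U))
      have h2 : IsClosedImmersion ((g ∣_ V p) ∣_ ((V p).ι ⁻¹ᵁ (q ⁻¹ᵁ U))) := IsZariskiLocalAtTarget.restrict (hV p) _
      have h3 : IsClosedImmersion (g ∣_ (V p).ι ''ᵁ ((V p).ι ⁻¹ᵁ (q ⁻¹ᵁ U))) :=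
        (MorphismProperty.arrow_mk_iso_iff @IsClosedImmersion e2).mp h2
      have h4 : ∀ (W' : P.Opens), W' = (V p).ι ''ᵁ ((V p).ι ⁻¹ᵁ (q ⁻¹ᵁ U)) → IsClosedImmersion (g ∣_ W') := by
        rintro W' rfl; exact h3
      exact (MorphismProperty.arrow_mk_iso_iff @IsClosedImmersion e1).mpr (h4 _ h1)
    -- the range is closed (`g` proper), so `g ∣_ q⁻¹U` is a closed immersion
    haveI : IsProper (g ∣_ q ⁻¹ᵁ U) := IsZariskiLocalAtTarget.restrict (P := @IsProper) inferInstance _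
    exact Motives.GeneratingSections.isClosedImmersion_of_restrict (g ∣_ q ⁻¹ᵁ U)
      (fun p : {p : P // q p = s} ↦ (q ⁻¹ᵁ U).ι ⁻¹ᵁ V p) hcov hV' (g ∣_ q ⁻¹ᵁ U).isClosedMap.isClosed_range

/-- **EGA III 4.6.7 (ii), fibre-morphism form.** As `exists_isClosedImmersion_morphismRestrict_preimage_of_fiber`, with the
hypothesis stated on a morphism of fibres `gs : X_s → P_s` (compatible with the projections) which is a closed immersion.
[cite: EGAIII1, Prop. 4.6.7 (ii)] -/
theorem exists_isClosedImmersion_morphismRestrict_preimage_of_fiberHom (hg : g ≫ q = f) [IsProper f] [IsSeparated q]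
    (s : S) (gs : f.fiber s ⟶ q.fiber s) (h₁ : gs ≫ q.fiberι s = f.fiberι s ≫ g)
    (h₂ : gs ≫ q.fiberToSpecResidueField s = f.fiberToSpecResidueField s) (hgs : IsClosedImmersion gs) :
    ∃ U : S.Opens, s ∈ U ∧ IsClosedImmersion (g ∣_ q ⁻¹ᵁ U) :=
  exists_isClosedImmersion_morphismRestrict_preimage_of_fiber f q g hg s
    (isClosedImmersion_fiberToSpecResidueField_of_fiber f q g hg s gs h₁ h₂ hgs)

end Global


/-! ### Base change to an open `T → S` inside `U`, and the affine base `Spec A` -/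

section BaseChange

variable {X P S T : Scheme.{u}} (f : X ⟶ S) (q : P ⟶ S) (g : X ⟶ P)

/-- If `g` (with `g ≫ q = f`) is a closed immersion over `q⁻¹(U)`, then its base change `X ×_S T → P ×_S T` along any OPEN
immersion `ι : T → S` landing in `U` is a closed immersion (it is `g` restricted over the open `q⁻¹(ι(T)) ⊆ q⁻¹(U)`, up to
`X ×_P (P ×_S T) ≅ X ×_S T`). [cite: EGAIII1, Prop. 4.6.7 (ii)] -/
theorem isClosedImmersion_pullbackMap_of_isOpenImmersion (hg : g ≫ q = f) (U : S.Opens)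
    (hU : IsClosedImmersion (g ∣_ q ⁻¹ᵁ U)) (ι : T ⟶ S) [IsOpenImmersion ι] (hι : ι.opensRange ≤ U)
    (e₁ : f ≫ 𝟙 S = g ≫ q) (e₂ : ι ≫ 𝟙 S = 𝟙 T ≫ ι) :
    IsClosedImmersion (pullback.map f ι q ι g (𝟙 T) (𝟙 S) e₁ e₂) := by
  have hle : q ⁻¹ᵁ ι.opensRange ≤ q ⁻¹ᵁ U := fun x hx ↦ hι hx
  have hV : IsClosedImmersion (g ∣_ q ⁻¹ᵁ ι.opensRange) :=
    IsZariskiLocalAtTarget.of_isPullback (isPullback_morphismRestrict_homOfLE g hle) hU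
  -- `P ×_S T → P` is an open immersion with range `q⁻¹(ι(T))`
  have hV' : IsClosedImmersion (g ∣_ (pullback.fst q ι).opensRange) := by
    have e : (pullback.fst q ι).opensRange = q ⁻¹ᵁ ι.opensRange := Scheme.Hom.opensRange_pullbackFst _ _
    have h4 : ∀ W, W = q ⁻¹ᵁ ι.opensRange → IsClosedImmersion (g ∣_ W) := by
      rintro _ rfl; exact hV
    exact h4 _ e
  have h1 : IsClosedImmersion (pullback.snd g (pullback.fst q ι)) :=
    (MorphismProperty.arrow_mk_iso_iff @IsClosedImmersion (morphismRestrictOpensRange g (pullback.fst q ι))).mp hV'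
  -- `X ×_P (P ×_S T) ≅ X ×_S T`, matching `pullback.snd` with `pullback.map`
  have he₁ : (pullbackRightPullbackFstIso q ι g ≪≫ pullback.congrHom hg rfl).hom ≫ pullback.fst f ι =
      pullback.fst g (pullback.fst q ι) := by
    rw [Iso.trans_hom, Category.assoc, pullback.congrHom_hom, pullback.lift_fst, Category.comp_id,
      pullbackRightPullbackFstIso_hom_fst]
  have he₂ : (pullbackRightPullbackFstIso q ι g ≪≫ pullback.congrHom hg rfl).hom ≫ pullback.snd f ι =
      pullback.snd g (pullback.fst q ι) ≫ pullback.snd q ι := by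
    rw [Iso.trans_hom, Category.assoc, pullback.congrHom_hom, pullback.lift_snd, Category.comp_id,
      pullbackRightPullbackFstIso_hom_snd]
  have e4 : Arrow.mk (pullback.map f ι q ι g (𝟙 T) (𝟙 S) e₁ e₂) ≅ Arrow.mk (pullback.snd g (pullback.fst q ι)) := by
    refine Arrow.isoMk' _ _ (pullbackRightPullbackFstIso q ι g ≪≫ pullback.congrHom hg rfl).symm (Iso.refl _) ?_
    rw [Iso.refl_hom, Category.comp_id, Iso.symm_hom, Iso.inv_comp_eq]
    apply pullback.hom_ext
    · rw [Category.assoc, pullback.lift_fst, ← Category.assoc, he₁, pullback.condition]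
    · rw [Category.assoc, pullback.lift_snd, Category.comp_id, he₂]
  exact (MorphismProperty.arrow_mk_iso_iff @IsClosedImmersion e4).mpr h1

end BaseChange

section AffineBase

variable {A : Type u} [CommRing A] {X P : Scheme.{u}} (f : X ⟶ Spec (.of A)) (q : P ⟶ Spec (.of A)) (g : X ⟶ P)

/-- Over an affine base `Spec A`: if `g` (with `g ≫ q = f`) is a closed immersion over `q⁻¹(U)` for an open `U ∋ 𝔭`, then
for some `r ∉ 𝔭` (with `D(r) ⊆ U`) the base change `X ×_A A_r → P ×_A A_r` of `g` to `Spec A_r` is a closed immersion.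
[cite: EGAIII1, Prop. 4.6.7 (ii)] -/
theorem exists_isClosedImmersion_pullbackMap_away_of_morphismRestrict (hg : g ≫ q = f) (U : (Spec (.of A)).Opens)
    (𝔭 : PrimeSpectrum A) (h𝔭 : 𝔭 ∈ U) (hU : IsClosedImmersion (g ∣_ q ⁻¹ᵁ U)) :
    ∃ r : A, r ∉ 𝔭.asIdeal ∧ ∀ e₁ e₂, IsClosedImmersion
      (pullback.map f (Spec.map (CommRingCat.ofHom (algebraMap A (Localization.Away r)))) q
        (Spec.map (CommRingCat.ofHom (algebraMap A (Localization.Away r)))) g (𝟙 _) (𝟙 _) e₁ e₂) := by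
  obtain ⟨r, h𝔭r, hrU⟩ : ∃ r : A, r ∉ 𝔭.asIdeal ∧ (PrimeSpectrum.basicOpen r : Set (PrimeSpectrum A)) ⊆ (U : Set (Spec (.of A))) := by
    obtain ⟨_, ⟨r, rfl⟩, h1, h2⟩ :=
      PrimeSpectrum.isTopologicalBasis_basic_opens.exists_subset_of_mem_open h𝔭 U.isOpen
    exact ⟨r, h1, h2⟩
  refine ⟨r, h𝔭r, fun e₁ e₂ ↦ isClosedImmersion_pullbackMap_of_isOpenImmersion f q g hg U hU _ ?_ e₁ e₂⟩
  rintro _ ⟨x, rfl⟩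
  apply hrU
  show PrimeSpectrum.comap (algebraMap A (Localization.Away r)) x ∈ PrimeSpectrum.basicOpen r
  rw [← SetLike.mem_coe, ← PrimeSpectrum.localization_away_comap_range (Localization.Away r) r]
  exact ⟨x, rfl⟩

/-- **EGA III 4.6.7 (ii) over an affine base, base-change form.** `f : X → Spec A` proper, `q : P → Spec A` separated,
`g ≫ q = f`; if the scheme-theoretic fibre of `g` at every point of `P` over `𝔭` is a closed immersion, then for some
`r ∉ 𝔭` the base change `X ×_A A_r → P ×_A A_r` of `g` is a closed immersion. [cite: EGAIII1, Prop. 4.6.7 (ii)] -/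
theorem exists_isClosedImmersion_pullbackMap_away_of_fiber (hg : g ≫ q = f) [IsProper f] [IsSeparated q]
    (𝔭 : PrimeSpectrum A) (H : ∀ p : P, q p = 𝔭 → IsClosedImmersion (g.fiberToSpecResidueField p)) :
    ∃ r : A, r ∉ 𝔭.asIdeal ∧ ∀ e₁ e₂, IsClosedImmersion
      (pullback.map f (Spec.map (CommRingCat.ofHom (algebraMap A (Localization.Away r)))) q
        (Spec.map (CommRingCat.ofHom (algebraMap A (Localization.Away r)))) g (𝟙 _) (𝟙 _) e₁ e₂) := by
  obtain ⟨U, h𝔭, hU⟩ := exists_isClosedImmersion_morphismRestrict_preimage_of_fiber f q g hg 𝔭 H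
  exact exists_isClosedImmersion_pullbackMap_away_of_morphismRestrict f q g hg U 𝔭 h𝔭 hU

/-- **EGA III 4.6.7 (ii) over an affine base, base-change form, fibre-morphism hypothesis.** As
`exists_isClosedImmersion_pullbackMap_away_of_fiber` with the hypothesis on a morphism of fibres `gs : X_𝔭 → P_𝔭`
(compatible with the projections) which is a closed immersion. [cite: EGAIII1, Prop. 4.6.7 (ii)] -/
theorem exists_isClosedImmersion_pullbackMap_away_of_fiberHom (hg : g ≫ q = f) [IsProper f] [IsSeparated q]
    (𝔭 : PrimeSpectrum A) (gs : f.fiber 𝔭 ⟶ q.fiber 𝔭) (h₁ : gs ≫ q.fiberι 𝔭 = f.fiberι 𝔭 ≫ g)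
    (h₂ : gs ≫ q.fiberToSpecResidueField 𝔭 = f.fiberToSpecResidueField 𝔭) (hgs : IsClosedImmersion gs) :
    ∃ r : A, r ∉ 𝔭.asIdeal ∧ ∀ e₁ e₂, IsClosedImmersion
      (pullback.map f (Spec.map (CommRingCat.ofHom (algebraMap A (Localization.Away r)))) q
        (Spec.map (CommRingCat.ofHom (algebraMap A (Localization.Away r)))) g (𝟙 _) (𝟙 _) e₁ e₂) :=
  exists_isClosedImmersion_pullbackMap_away_of_fiber f q g hg 𝔭
    (isClosedImmersion_fiberToSpecResidueField_of_fiber f q g hg 𝔭 gs h₁ h₂ hgs)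

end AffineBase

end Literature.AlgebraicGeometry.Morphisms
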